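import Mathlib
import HarnessLib
import Summits.NavierStokesRegularity.NavierStokesRegularity.Theorems.TaylorModelRungThreeCertificateCloserV
import Summits.NavierStokesRegularity.NavierStokesRegularity.Theorems.TaylorModelRungThreeCertificateFormatVGrowthFast

/-!
# Crux K1b-DR (stmt-NavierStokesRegularity-23954), line `taylor-model` — v3 certificate: CLOSERS for the FAST growth entry points
# (tm-g4 g5)

`CertTablesV.k1bDR_of_checksVRGF'` / `k1bDR_of_checksVRG2F'` — the landed closers `k1bDR_of_checksVRG'` (v1) / `…VRG2'`
(variant B) of `…CertificateCloserV` restated with the FAST chunk Booleans `growthRangeF` / `growthRange2F` of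
`…CertificateFormatVGrowthFast` (value-identical twins: `growthRangeF_eq`, `growthRange2F_eq`); every other binder verbatim. The
generated chunk files should evaluate the FAST Booleans (`growthRangeF kitOf wT (r4 j) j L q = true` by `native_decide`).
A separate module so that nothing landed is touched. MODEL-lattice bookkeeping only (rung TL-M3); nothing here is a statement
about the Navier–Stokes equations; K1b-DR is NOT proved here (that needs an emitted certificate whose Booleans evaluate to `true`).
-/

-- the sub-problem namespace repeats the summit name by design (D-0017)
set_option linter.dupNamespace false

namespace Summit.NavierStokesRegularity.NavierStokesRegularity.Theorems.TaylorModelCert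

namespace CertTablesV

variable (TV : CertTablesV) (kitOf : ℕ → CoreKit) (wT : ℕ → Array Dyad)

/-- **THE v3 CLOSER FROM BOOLEANS, FAST v1 GROWTH RUNS**: as `k1bDR_of_checksVRG'` with `growthRangeF` (`= growthRange`).
[folklore] -/
theorem k1bDR_of_checksVRGF' (sc : ScalarsV) (A : ReadoutAux QS2) (B : StageAux QS2) (B'' : StaticAux QS2)
    (hcoef : TV.base.checkCoef = true) (hS : TV.base.checkStatic B'' = true)
    (hSN : TV.base.checkStageNumerics A B = true) (hk : KitOK TV kitOf)
    (hnode0 : ∀ j, j ≤ TV.base.N₀ → nodeOK TV.base.n TV.prec (TV.ctxOfW kitOf wT j).N0 = true)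
    (hrB : ∀ j, j ≤ TV.base.N₀ → nonnegVec TV.base.n (TV.stageV j).rB = true)
    (hK : CoreChecksOK TV wT) (hE : ∀ j, j ≤ TV.base.N₀ → TV.checkEntryV j = true)
    (hchk' : TV.checkReadouts' kitOf wT A = true) {L : ℕ} (hL : 0 < L)
    (hGR : ∀ j, j ≤ TV.base.N₀ → ∀ q, q * L < TV.S j →
      TV.growthRangeF kitOf wT (fun _ co => TV.base.testR4 TV.MB (TV.AB j) co) j L q = true)
    (hcL : ∀ j, j ≤ TV.base.N₀ → TV.checkL1 j = true) (hc0 : ∀ j, j ≤ TV.base.N₀ → TV.checkR0 j = true)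
    (hc1 : ∀ j, j ≤ TV.base.N₀ → TV.checkR1 wT j = true) :
    Summit.NavierStokesRegularity.NavierStokesRegularity.Theses.ExactWindowRungThree.DerivativeEnclosureCertificateR :=
  TV.k1bDR_of_checksVRG' kitOf wT sc A B B'' hcoef hS hSN hk hnode0 hrB hK hE hchk' hL
    (fun j hj q hq => by rw [← growthRangeF_eq]; exact hGR j hj q hq) hcL hc0 hc1

/-- **THE v3 CLOSER FROM BOOLEANS, FAST TWO-LEVEL GROWTH RUNS** (variant B): as `k1bDR_of_checksVRG2'` with `growthRange2F`
(`= growthRange2`). [folklore] -/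
theorem k1bDR_of_checksVRG2F' (sc : ScalarsV) (A : ReadoutAux QS2) (B : StageAux QS2) (B'' : StaticAux QS2)
    (hcoef : TV.base.checkCoef = true) (hS : TV.base.checkStatic B'' = true)
    (hSN : TV.base.checkStageNumerics A B = true) (hk : KitOK TV kitOf)
    (hnode0 : ∀ j, j ≤ TV.base.N₀ → nodeOK TV.base.n TV.prec (TV.ctxOfW kitOf wT j).N0 = true)
    (hrB : ∀ j, j ≤ TV.base.N₀ → nonnegVec TV.base.n (TV.stageV j).rB = true)
    (hK : CoreChecksOK TV wT) (hE : ∀ j, j ≤ TV.base.N₀ → TV.checkEntryV j = true)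
    (hchk' : TV.checkReadouts' kitOf wT A = true) {L ℓ : ℕ} (hL : 0 < L) (hℓ : 0 < ℓ) (hdvd : ℓ ∣ L)
    (hGR : ∀ j, j ≤ TV.base.N₀ → ∀ q, q * L < TV.S j →
      TV.growthRange2F kitOf wT (fun _ co => TV.base.testR4 TV.MB (TV.AB j) co) j L ℓ q = true)
    (hcL : ∀ j, j ≤ TV.base.N₀ → TV.checkL1 j = true) (hc0 : ∀ j, j ≤ TV.base.N₀ → TV.checkR0 j = true)
    (hc1 : ∀ j, j ≤ TV.base.N₀ → TV.checkR1 wT j = true) :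
    Summit.NavierStokesRegularity.NavierStokesRegularity.Theses.ExactWindowRungThree.DerivativeEnclosureCertificateR :=
  TV.k1bDR_of_checksVRG2' kitOf wT sc A B B'' hcoef hS hSN hk hnode0 hrB hK hE hchk' hL hℓ hdvd
    (fun j hj q hq => by rw [← growthRange2F_eq]; exact hGR j hj q hq) hcL hc0 hc1

end CertTablesV

end Summit.NavierStokesRegularity.NavierStokesRegularity.Theorems.TaylorModelCert
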